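import Literature.Topology.FourManifolds.LeftHandDiscRetractionBox
import Literature.Topology.FourManifolds.LeftHandSphereLocal
import Literature.Topology.FourManifolds.MilnorBoxChartMap
import Literature.Topology.FourManifolds.SaddlePassageModel
import HarnessLib

/-!
# Flow lines in a Milnor box: the flow follows the model flow; exits and entrances

Topic `Literature/Topology/FourManifolds` (support file for the two-field handle-extension
endgame of `stmt-SmoothPoincare4-15190`, after `SaddlePassageModel.lean`,
`MilnorBoxChartMap.lean`).  Everything here is **proved**; no definitions.

Milnor, *Lectures on the h-cobordism theorem* (1965), Def. 3.1 (2) and proof of Thm. 3.12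
(PDF pp. 12, 18): in a Milnor box `D : Literature.Topology.FourManifolds.MilnorBox J f X q`
(`f = f q + Q_k(u)`, `dφ̂ X = F_k(u)`) the trajectories of `X` are, in the centred coordinates
`u`, the model trajectories `Φ_t(u) = (e^{-t} x⃗, e^{t} y⃗)`
(`Literature.Topology.FourManifolds.milnorFlow`).  For a smooth global flow `θ` of `X`:

* `MilnorBox.flow_pt_eq` — **`θ (s, ψ w) = ψ (Φ_s w)` as long as the model orbit stays in the
  `3ε`-ball** between the times `0` and `s` (uniqueness of integral curves; the case of the
  rays, `LeftHandSphereLocal.flow_symm_add_eq`, generalised), and by convexity of `‖Φ_t w‖²`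
  it suffices that the two ends lie in the ball (`flow_pt_eq_of_endpoints`);
* `MilnorBox.exists_exit_level` — **exit**: a point `z` of the ball with `y⃗ ≠ 0` below the level
  `f q + L'` (`L' > 0`) is carried by the forward flow, inside the ball, to that level, at a
  point with `|x⃗|² ≤ |x⃗|²|y⃗|²(z) / L'` (`SaddlePassageModel.lean`), provided
  `L' + 2|x⃗|²|y⃗|²(z)/L' < 9ε²`; `MilnorBox.exists_entrance_level` — the symmetric statement for the
  backward flow and the level `f q - L'`.

## References

* J. Milnor, *Lectures on the h-cobordism theorem* (1965), Def. 3.1, proof of Thm. 3.12 (PDF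
  pp. 12, 18). [MilnorHCobordism1965]
* J. M. Lee, *Introduction to Smooth Manifolds*, 2nd ed. (2012), Thm. 9.12. [LeeSmoothManifolds2013]
-/

open scoped Manifold ContDiff Topology
open Set Function Filter Metric

noncomputable section

namespace Literature.Topology.FourManifolds

universe u

namespace MilnorBox

variable {m : ℕ} {H : Type*} [TopologicalSpace H] {J : ModelWithCorners ℝ (EuclideanSpace ℝ (Fin m)) H}
  {M : Type u} [TopologicalSpace M] [ChartedSpace H M]
  {f : M → ℝ} {X : Π x : M, TangentSpace J x} {q : M} (D : MilnorBox J f X q)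

/-! ### Chart points by the norm of their coordinates -/

/-- `ψ w` lies in the chart domain for `‖w‖ ≤ 3ε`. [folklore] -/
theorem pt_mem_source_of_norm_le {w : EuclideanSpace ℝ (Fin m)} (hw : ‖w‖ ≤ 3 * D.ε) :
    D.pt w ∈ D.chart.source := D.symm_add_mem_source hw

/-- `coord (ψ w) = w` for `‖w‖ ≤ 3ε`. [folklore] -/
theorem coord_pt_of_norm_le {w : EuclideanSpace ℝ (Fin m)} (hw : ‖w‖ ≤ 3 * D.ε) : D.coord (D.pt w) = w :=
  D.coord_symm_add hw

/-- `ψ w` lies in the chart ball of radius `R ≤ 3ε` for `‖w‖ < R`. [folklore] -/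
theorem pt_mem_chartBall {R : ℝ} (hR : R ≤ 3 * D.ε) {w : EuclideanSpace ℝ (Fin m)} (hw : ‖w‖ < R) :
    D.pt w ∈ D.chartBall R := D.symm_add_mem_chartBall hR hw

/-- `f (ψ w) = f q + Q_k(w)` for `‖w‖ ≤ 3ε`. [cite: MilnorHCobordism1965, Def. 3.1 (2) (PDF p. 12)] -/
theorem apply_pt_of_norm_le {w : EuclideanSpace ℝ (Fin m)} (hw : ‖w‖ ≤ 3 * D.ε) :
    f (D.pt w) = f q + milnorQuadratic D.k w := by
  have h := D.apply_eq _ (D.pt_mem_source_of_norm_le hw)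
  rw [h]
  show f q + milnorQuadratic D.k (D.coord (D.pt w)) = _
  rw [D.coord_pt_of_norm_le hw]

/-- A point of the chart ball is `ψ` of its coordinates. [folklore] -/
theorem pt_coord_of_mem_chartBall {R : ℝ} {z : M} (hz : z ∈ D.chartBall R) : D.pt (D.coord z) = z :=
  D.pt_coord hz.1

/-! ### The model orbits are integral curves -/

/-- **The curves `t ↦ ψ (Φ_t w)` are integral curves of `X`** at every time at which
`‖Φ_t w‖ < 3ε`. [cite: MilnorHCobordism1965, Def. 3.1 (2), proof of Thm. 3.12 (PDF pp. 12, 18)] -/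
theorem isMIntegralCurveOn_pt_milnorFlow (w : EuclideanSpace ℝ (Fin m)) :
    IsMIntegralCurveOn (fun t => D.pt (milnorFlow D.k t w)) X {t | ‖milnorFlow D.k t w‖ < 3 * D.ε} := by
  set u₀ : EuclideanSpace ℝ (Fin m) := D.chart.extend J q with hu₀
  have hV : ∀ q' ∈ D.chart.source, mfderiv J 𝓘(ℝ, EuclideanSpace ℝ (Fin m)) (D.chart.extend J) q' (X q') =
      milnorModelField D.k (D.chart.extend J q' - u₀) := fun q' hq' => D.mfderiv_eq q' hq'
  have hO : Metric.ball u₀ (3 * D.ε) ⊆ (D.chart.extend J).target :=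
    Metric.ball_subset_closedBall.trans D.closedBall_subset
  refine isMIntegralCurveOn_extend_symm_comp D.mem_maximalAtlas
    (V := fun u => milnorModelField D.k (u - u₀)) hV Metric.isOpen_ball hO
    (c := fun t => u₀ + milnorFlow D.k t w) (fun t ht => ?_) (fun t _ => ?_)
  · rw [Metric.mem_ball, dist_eq_norm, add_sub_cancel_left]
    exact ht
  · exact hasDerivAt_const_add_milnorFlow D.k u₀ w t

/-! ### The flow follows the model flow -/

variable {θ : ℝ × M → M} [IsManifold J ∞ M] [T2Space M]

/-- **`θ (s, ψ w) = ψ (Φ_s w)` as long as the model orbit stays in the `3ε`-ball** between the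
times `0` and `s`. [cite: MilnorHCobordism1965, proof of Thm. 3.12 (PDF p. 18)] [cite: LeeSmoothManifolds2013, Thm. 9.12] -/
theorem flow_pt_eq (hθ : IsSmoothFlow J X θ)
    (hX : ContMDiff J J.tangent ∞ fun x => (⟨x, X x⟩ : TangentBundle J M))
    {w : EuclideanSpace ℝ (Fin m)} {s : ℝ}
    (hmem : ∀ t ∈ Icc (min s 0) (max s 0), ‖milnorFlow D.k t w‖ < 3 * D.ε) :
    θ (s, D.pt w) = D.pt (milnorFlow D.k s w) := by
  set γ : ℝ → M := fun t => D.pt (milnorFlow D.k t w) with hγ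
  have h₁ : IsMIntegralCurveOn (fun t => θ (t, D.pt w)) X (Icc (min s 0) (max s 0)) :=
    (hθ.isMIntegralCurve _).isMIntegralCurveOn _
  have h₂ : IsMIntegralCurveOn γ X (Icc (min s 0) (max s 0)) :=
    (D.isMIntegralCurveOn_pt_milnorFlow w).mono fun t ht => hmem t ht
  have h0 : (fun t => θ (t, D.pt w)) 0 = γ 0 := by
    simp only [hγ, milnorFlow_zero, hθ.map_zero]
  have := IsMIntegralCurveOn.eqOn_Icc hX h₁ h₂ ⟨min_le_right s 0, le_max_right s 0⟩ h0
    ⟨min_le_left s 0, le_max_left s 0⟩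
  exact this

/-- **It suffices that the two ends lie in the ball** (convexity of `‖Φ_t w‖²`). [cite: MilnorHCobordism1965, proof of Thm. 3.12 (PDF p. 18)] -/
theorem flow_pt_eq_of_endpoints (hθ : IsSmoothFlow J X θ)
    (hX : ContMDiff J J.tangent ∞ fun x => (⟨x, X x⟩ : TangentBundle J M))
    {w : EuclideanSpace ℝ (Fin m)} {s : ℝ} (h0 : ‖w‖ < 3 * D.ε) (hs : ‖milnorFlow D.k s w‖ < 3 * D.ε) :
    θ (s, D.pt w) = D.pt (milnorFlow D.k s w) := by
  refine D.flow_pt_eq hθ hX fun t ht => ?_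
  have hε : 0 ≤ 3 * D.ε := by linarith [D.eps_pos]
  have h0' : ‖milnorFlow D.k 0 w‖ < 3 * D.ε := by rw [milnorFlow_zero]; exact h0
  rcases le_total s 0 with hs0 | h0s
  · rw [min_eq_left hs0, max_eq_right hs0] at ht
    exact norm_milnorFlow_lt_of_endpoints D.k hε ht hs h0'
  · rw [min_eq_right h0s, max_eq_left h0s] at ht
    exact norm_milnorFlow_lt_of_endpoints D.k hε ht h0' hs

/-- **The flow of a point of the `3ε`-ball, in coordinates**: `θ (s, z) = ψ (Φ_s (coord z))`
whenever `‖Φ_s (coord z)‖ < 3ε`. [cite: MilnorHCobordism1965, proof of Thm. 3.12 (PDF p. 18)] -/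
theorem flow_eq_pt_milnorFlow (hθ : IsSmoothFlow J X θ)
    (hX : ContMDiff J J.tangent ∞ fun x => (⟨x, X x⟩ : TangentBundle J M))
    {z : M} (hz : z ∈ D.chartBall (3 * D.ε)) {s : ℝ} (hs : ‖milnorFlow D.k s (D.coord z)‖ < 3 * D.ε) :
    θ (s, z) = D.pt (milnorFlow D.k s (D.coord z)) := by
  have h := D.flow_pt_eq_of_endpoints hθ hX (w := D.coord z) hz.2 hs
  rwa [D.pt_coord_of_mem_chartBall hz] at h

/-- Under the same hypotheses the flow point lies in the `3ε`-ball … [folklore] -/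
theorem flow_mem_chartBall (hθ : IsSmoothFlow J X θ)
    (hX : ContMDiff J J.tangent ∞ fun x => (⟨x, X x⟩ : TangentBundle J M))
    {z : M} (hz : z ∈ D.chartBall (3 * D.ε)) {s : ℝ} (hs : ‖milnorFlow D.k s (D.coord z)‖ < 3 * D.ε) :
    θ (s, z) ∈ D.chartBall (3 * D.ε) := by
  rw [D.flow_eq_pt_milnorFlow hθ hX hz hs]
  exact D.pt_mem_chartBall le_rfl hs

/-- … with coordinates `Φ_s (coord z)` … [folklore] -/
theorem coord_flow (hθ : IsSmoothFlow J X θ)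
    (hX : ContMDiff J J.tangent ∞ fun x => (⟨x, X x⟩ : TangentBundle J M))
    {z : M} (hz : z ∈ D.chartBall (3 * D.ε)) {s : ℝ} (hs : ‖milnorFlow D.k s (D.coord z)‖ < 3 * D.ε) :
    D.coord (θ (s, z)) = milnorFlow D.k s (D.coord z) := by
  rw [D.flow_eq_pt_milnorFlow hθ hX hz hs, D.coord_pt_of_norm_le hs.le]

/-- … and level `f q + Q_k(Φ_s (coord z))`. [cite: MilnorHCobordism1965, Def. 3.1 (2) (PDF p. 12)] -/
theorem apply_flow (hθ : IsSmoothFlow J X θ)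
    (hX : ContMDiff J J.tangent ∞ fun x => (⟨x, X x⟩ : TangentBundle J M))
    {z : M} (hz : z ∈ D.chartBall (3 * D.ε)) {s : ℝ} (hs : ‖milnorFlow D.k s (D.coord z)‖ < 3 * D.ε) :
    f (θ (s, z)) = f q + milnorQuadratic D.k (milnorFlow D.k s (D.coord z)) := by
  rw [D.flow_eq_pt_milnorFlow hθ hX hz hs, D.apply_pt_of_norm_le hs.le]

/-! ### Exits and entrances -/

/-- **Exit.**  A point `z` of the `3ε`-ball with `y⃗ ≠ 0` and level `≤ f q + L'` (`L' > 0`)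
is carried by the forward flow to the level `f q + L'`, inside the ball, arriving with
`|x⃗|² ≤ |x⃗|²|y⃗|²(z) / L'` — provided `L' + 2|x⃗|²|y⃗|²(z)/L' < 9ε²`. [cite: MilnorHCobordism1965, proof of Thm. 3.12 (PDF p. 18)] -/
theorem exists_exit_level (hθ : IsSmoothFlow J X θ)
    (hX : ContMDiff J J.tangent ∞ fun x => (⟨x, X x⟩ : TangentBundle J M))
    {z : M} (hz : z ∈ D.chartBall (3 * D.ε)) (hb : 0 < sqSumGE D.k (D.coord z)) {L' : ℝ} (hL0 : 0 < L')
    (hL : milnorQuadratic D.k (D.coord z) ≤ L')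
    (hroom : L' + 2 * (sqSumLT D.k (D.coord z) * sqSumGE D.k (D.coord z) / L') < (3 * D.ε) ^ 2) :
    ∃ t, 0 ≤ t ∧ f (θ (t, z)) = f q + L' ∧
      sqSumLT D.k (D.coord (θ (t, z))) ≤ sqSumLT D.k (D.coord z) * sqSumGE D.k (D.coord z) / L' ∧
      ∀ s ∈ Icc 0 t, θ (s, z) ∈ D.chartBall (3 * D.ε) ∧ D.coord (θ (s, z)) = milnorFlow D.k s (D.coord z) := by
  set u := D.coord z with hu
  obtain ⟨t, ht0, htL⟩ := exists_milnorQuadratic_milnorFlow_eq_of_le D.k hb hL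
  set v := milnorFlow D.k t u with hv
  have hε : 0 ≤ 3 * D.ε := by linarith [D.eps_pos]
  -- the exit point is close to the `y⃗`-axis and inside the ball
  have hA : sqSumLT D.k v ≤ sqSumLT D.k u * sqSumGE D.k u / L' := by
    have h1 := sqSumLT_le_of_milnorQuadratic_eq D.k hL0 htL
    rwa [sqSumLT_mul_sqSumGE_milnorFlow] at h1
  have hvn : ‖v‖ < 3 * D.ε := by
    have h1 : ‖v‖ ^ 2 = L' + 2 * sqSumLT D.k v := norm_sq_eq_of_milnorQuadratic_eq D.k htL
    have h2 : ‖v‖ ^ 2 < (3 * D.ε) ^ 2 := by rw [h1]; linarith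
    exact (pow_lt_pow_iff_left₀ (norm_nonneg _) hε two_ne_zero).1 h2
  have hun : ‖milnorFlow D.k 0 u‖ < 3 * D.ε := by rw [milnorFlow_zero]; exact hz.2
  have hin : ∀ s ∈ Icc 0 t, ‖milnorFlow D.k s u‖ < 3 * D.ε := fun s hs =>
    norm_milnorFlow_lt_of_endpoints D.k hε hs hun hvn
  refine ⟨t, ht0, ?_, ?_, fun s hs => ⟨D.flow_mem_chartBall hθ hX hz (hin s hs), D.coord_flow hθ hX hz (hin s hs)⟩⟩
  · rw [D.apply_flow hθ hX hz (hin t ⟨ht0, le_rfl⟩), htL]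
  · rw [D.coord_flow hθ hX hz (hin t ⟨ht0, le_rfl⟩)]; exact hA

/-- **Entrance.**  A point `z` of the `3ε`-ball with `x⃗ ≠ 0` and level `≥ f q - L'` (`L' > 0`)
comes, by the backward flow inside the ball, from the level `f q - L'`, from a point with
`|y⃗|² ≤ |x⃗|²|y⃗|²(z) / L'` — provided `L' + 2|x⃗|²|y⃗|²(z)/L' < 9ε²`. [cite: MilnorHCobordism1965, proof of Thm. 3.12 (PDF p. 18)] -/
theorem exists_entrance_level (hθ : IsSmoothFlow J X θ)
    (hX : ContMDiff J J.tangent ∞ fun x => (⟨x, X x⟩ : TangentBundle J M))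
    {z : M} (hz : z ∈ D.chartBall (3 * D.ε)) (ha : 0 < sqSumLT D.k (D.coord z)) {L' : ℝ} (hL0 : 0 < L')
    (hL : -L' ≤ milnorQuadratic D.k (D.coord z))
    (hroom : L' + 2 * (sqSumLT D.k (D.coord z) * sqSumGE D.k (D.coord z) / L') < (3 * D.ε) ^ 2) :
    ∃ t, t ≤ 0 ∧ f (θ (t, z)) = f q - L' ∧
      sqSumGE D.k (D.coord (θ (t, z))) ≤ sqSumLT D.k (D.coord z) * sqSumGE D.k (D.coord z) / L' ∧
      ∀ s ∈ Icc t 0, θ (s, z) ∈ D.chartBall (3 * D.ε) ∧ D.coord (θ (s, z)) = milnorFlow D.k s (D.coord z) := by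
  set u := D.coord z with hu
  obtain ⟨t, ht0, htL⟩ := exists_milnorQuadratic_milnorFlow_eq_of_ge D.k ha hL
  set v := milnorFlow D.k t u with hv
  have hε : 0 ≤ 3 * D.ε := by linarith [D.eps_pos]
  have hB : sqSumGE D.k v ≤ sqSumLT D.k u * sqSumGE D.k u / L' := by
    have h1 := sqSumGE_le_of_milnorQuadratic_eq_neg D.k hL0 htL
    rwa [sqSumLT_mul_sqSumGE_milnorFlow] at h1
  have hvn : ‖v‖ < 3 * D.ε := by
    have h1 : ‖v‖ ^ 2 = L' + 2 * sqSumGE D.k v := norm_sq_eq_of_milnorQuadratic_eq_neg D.k htL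
    have h2 : ‖v‖ ^ 2 < (3 * D.ε) ^ 2 := by rw [h1]; linarith
    exact (pow_lt_pow_iff_left₀ (norm_nonneg _) hε two_ne_zero).1 h2
  have hun : ‖milnorFlow D.k 0 u‖ < 3 * D.ε := by rw [milnorFlow_zero]; exact hz.2
  have hin : ∀ s ∈ Icc t 0, ‖milnorFlow D.k s u‖ < 3 * D.ε := fun s hs =>
    norm_milnorFlow_lt_of_endpoints D.k hε hs hvn hun
  refine ⟨t, ht0, ?_, ?_, fun s hs => ⟨D.flow_mem_chartBall hθ hX hz (hin s hs), D.coord_flow hθ hX hz (hin s hs)⟩⟩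
  · rw [D.apply_flow hθ hX hz (hin t ⟨le_rfl, ht0⟩), htL]; ring
  · rw [D.coord_flow hθ hX hz (hin t ⟨le_rfl, ht0⟩)]; exact hB

/-! ### Orbit segments inside the ball -/

/-- **An orbit segment whose model image stays in the ball is followed by the flow**: for
`z` in the `3ε`-ball and all `s` between `0` and `t` with `‖Φ_s (coord z)‖ < 3ε`, the points
`θ (s, z)` lie in the ball with coordinates `Φ_s (coord z)`. [cite: MilnorHCobordism1965, proof of Thm. 3.12 (PDF p. 18)] -/
theorem flow_mem_chartBall_of_forall (hθ : IsSmoothFlow J X θ)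
    (hX : ContMDiff J J.tangent ∞ fun x => (⟨x, X x⟩ : TangentBundle J M))
    {z : M} (hz : z ∈ D.chartBall (3 * D.ε)) {T₁ T₂ : ℝ}
    (h : ∀ s ∈ Icc T₁ T₂, ‖milnorFlow D.k s (D.coord z)‖ < 3 * D.ε) :
    ∀ s ∈ Icc T₁ T₂, θ (s, z) ∈ D.chartBall (3 * D.ε) ∧ D.coord (θ (s, z)) = milnorFlow D.k s (D.coord z) :=
  fun s hs => ⟨D.flow_mem_chartBall hθ hX hz (h s hs), D.coord_flow hθ hX hz (h s hs)⟩

/-- The same with the endpoint criterion: if `‖Φ_{T₁} u‖, ‖Φ_{T₂} u‖ < 3ε` (`u = coord z`) then the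
whole segment `θ ([T₁, T₂], z)` lies in the ball. [folklore] -/
theorem flow_mem_chartBall_of_endpoints (hθ : IsSmoothFlow J X θ)
    (hX : ContMDiff J J.tangent ∞ fun x => (⟨x, X x⟩ : TangentBundle J M))
    {z : M} (hz : z ∈ D.chartBall (3 * D.ε)) {T₁ T₂ : ℝ}
    (h₁ : ‖milnorFlow D.k T₁ (D.coord z)‖ < 3 * D.ε) (h₂ : ‖milnorFlow D.k T₂ (D.coord z)‖ < 3 * D.ε) :
    ∀ s ∈ Icc T₁ T₂, θ (s, z) ∈ D.chartBall (3 * D.ε) ∧ D.coord (θ (s, z)) = milnorFlow D.k s (D.coord z) :=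
  D.flow_mem_chartBall_of_forall hθ hX hz fun s hs =>
    norm_milnorFlow_lt_of_endpoints D.k (by linarith [D.eps_pos]) hs h₁ h₂

end MilnorBox

end Literature.Topology.FourManifolds
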